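import Mathlib
import Summits.QuantumFields.YangMills.Theorems.BalabanUVNodesN15BasisDictionary
import Summits.QuantumFields.YangMills.Theorems.BalabanUVNodesN15ShiftSpecies
import HarnessLib

/-!
# Route «BalabanUVNodes» (cluster K4 «SpineRates»), Track-A DAG node N15 = spine estimate NE2, BACKGROUND LAYER — FIRST MISSING
# ESTIMATE, part 17: THE PRINT's FIRST-ORDER PERTURBATION `V′₁(A)` OF (3.52), ONE LATTICE DIRECTION, MATRIX COEFFICIENTS, ALL THREE TERMS
# SANDWICHED — `V = M_{C₁}∘∇_η + M_{C₂} + M_{C₃}∘pull s` on the product carrier `X × ι`: the η-defect `T′ ∘ 𝔇(V′, V) ∘ A` is source-weighted,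
# `≤ (K₁ + K₂ + K₃)·e^{−ρd(y,y′)}·w(y′)`, every constant ONE rate factor, from (3.35)∕(3.36)-SHAPED field letters, (3.42)-SHAPED factor entries,
# the box∕block conventions and the basis constant `κ_e` of part 16

Cell `pub-ymgap`, seat `pub-ymgap-dag-n15-b` (generation g3; FIRST-MISSING-ESTIMATE, HUMAN RULING D-0062; chair R424 venue; ROSTER-D0062
l.26).  `bears_on: R4∕N15`.  Filed `--supports stmt-QuantumFields-19351`.  The CAPSTONE of this seat's coefficient-species programme for STEP 2
(NE2-LOCAL-A) of the record `t4/T4-EST-U1a.md` §3: g0 files 1–11 (derivative∕coefficient defects, background step), g2 12a–12e (scalar species), g3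
13a–16 (matrix species, product carrier, shift species, basis dictionary) — assembled for the print's `V′₁(A)`, one direction at a time (the sum
over the `2d` bond directions is g0 file 4's `hasMaj_comp_idef_sum_comp`, generic).

WHY.  [Balaban1985BackgroundPropagators] (3.52) p. 400 (verbatim, first-hand): *«V′₁(A)λ(x) = Σ_{b∈st(x)} i[A′(b), (D^η_U λ)(b)] + i[(D^{η*}_U A)(x),
λ(x)] + Σ_{b∈st(x)} F′_{1,k}(i ad_{A′(b)}) λ(b₊)»*.  Per direction `μ` this is `M_{C₁}∘∇_μ + M_{C₂} + M_{C₃}∘pull s_μ` with the THREE MATRIX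
COEFFICIENTS `C₁ = ad_{A(·,μ)}` (LINEAR species), `C₂ = ad_{(D*A)(·)}` (linear species of the DIFFERENTIATED field, 12b's S2) shared among directions,
`C₃ = F′_{1,k}(ad_{A(·,μ)})` (13b's `Phi2 ∘ ad`) followed by the TRANSLATION `λ(b₊)` (15's shift species).  Binder (d) of g0's background step
(`…N15.BackgroundStep.idef_background_propagator_majorant`: the sandwiched `G₁′∘𝔇(V′, V)∘X`) is therefore, for the print's own `V′₁`, the sum
of: T1 = part 14's first-order matrix sandwich, T2 = part 14's zeroth-order matrix sandwich, T3 = part 15's coefficient-times-shift sandwich for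
matrix coefficients (§1 here).  THE PRINT USED (SHAPES only): (3.35)∕(3.36) p. 396, (3.42) p. 397, (3.50)–(3.52) p. 400; [B6] (2.54) p. 233.  Nothing
of [B9] asserted.

CONTENTS (all [folklore]; parts 13a∕13b∕14∕15∕16, g0 files 1∕2∕4∕11, `T4EtaRateDefect`, `T4EtaRateCoeffDefect` BY NAME).
* §1 T3 FOR MATRIX COEFFICIENTS on the product carrier: `idef_mcoeffShift_eq` (Leibniz), `hasMaj_comp_mmulOp_left` (`T′∘M_{C′} ≤ α·N_T` from row sums
  `≤ α`), `hasMaj_comp_idef_mcoeffShift_comp` (15's `hasMaj_comp_idef_coeffShift_comp` with `mulOp ↦ mmulOp`: shift piece = 15's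
  `hasMaj_comp_idef_pull_shift_comp_weighted` ON `prodLine D ι` BY NAME, coefficient piece = 14's `hasMaj_idef_mmulOp_comp_transfer` on the shifted
  right factor).
* §2 **`hasMaj_comp_idef_V1dir_comp`** — ONE DIRECTION OF `V′₁(A)`, ALL THREE TERMS: `T′ ∘ 𝔇(M_{C₁′}∇′ + M_{C₂′} + M_{C₃′}pull s′, M_{C₁}∇ + M_{C₂} +
  M_{C₃}pull s) ∘ A ≤ (K₁ + K₂ + K₃)·e^{−ρd}·w(y′)`, `K₁ = m₃A₁c′_η + m_Tε₁A₁C` (14), `K₂ = m_Tε₂A₀C` (14), `K₃ = α₃m_TA₁c_η + m_Tε₃A_sC` (§1); BINDER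
  CENSUS in its docstring.
* §3 THE THREE COEFFICIENT LETTER SETS FROM FIELD LETTERS in coordinates `e` (16's `κ_e`): `rowFit_ad` (C₁∕C₂: fit rows `≤ κ_e·2·o` from the field
  fit `o`, 13a `norm_adCLM_sub_le`), `rowBound_ad` (rows `≤ κ_e·2r`), `rowDiff_ad` (backward-difference rows `≤ κ_e·2·G` from `‖A′(x′) − A′(s′⁻¹x′)‖ ≤
  η′G`), `norm_Phi2_le` (`‖Phi2 η Z‖ ≤ e·ρ_Z·‖Z‖`, `Phi2 η 0 = 0`), `rowBound_Phi2_ad`, `rowFit_Phi2_ad` (C₃: 13b's `fit_Phi2_ad` through 16).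

HONEST FRAMING ∕ LIMITS.  MECHANISM over hypothesis-SHAPED letters; ONE direction (directions sum by file 4's `hasMaj_comp_idef_sum_comp`); `U ≡ 1`
lattice derivatives and translations in the model (the print's `D^η_U` carries parallel transports — their coefficient is 13b's transporter species,
composable by the same Leibniz rule, not spelled out here); the factor entries `N_T`, `N₃`, `A₀`, `A₁`, `A_s` and the weight letters are BINDERS of
printed shape ((3.42), (3.63), [B6] (2.60)), as in g0's background step.  NE2⁺ NOT PRINTED, NOT proved; count-neutral (typed 28∕28; nothing
discharged); one finite T⁴ at fixed ε — NOT infinite volume, NOT OS on ℝ⁴, NOT a mass gap, NOT Clay.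
-/

noncomputable section

namespace Summit.QuantumFields.YangMills.BalabanUVNodes.N15.MatrixSpecies

open Literature.MathematicalPhysics.QuantumFieldTheory.Balaban1983to89
open Literature.MathematicalPhysics.QuantumFieldTheory.Balaban1983to89.T4EtaRateDefect (idef idef_apply idef_comp idef_add SlowWeight
  hasMaj_comp_transfer hasMaj_comp_wrow_source)
open Literature.MathematicalPhysics.QuantumFieldTheory.Balaban1983to89.T4EtaRateCoeffDefect (pull pull_apply diagK diagK_same diagK_ne
  diagK_nonneg)
open Literature.MathematicalPhysics.QuantumFieldTheory.Balaban1983to89.Beta.AveragingCorrectionJets (adCLM norm_adCLM_le)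
open B6RandomWalk B11SectG B9SectDWeightedNeumann Finset
open Summit.QuantumFields.YangMills.BalabanUVNodes.N15.DerivDefect
open Summit.QuantumFields.YangMills.BalabanUVNodes.N15.ShiftSpecies (hasMaj_comp_idef_pull_shift_comp_weighted wrow_const_mul)

/-! ## §1 The third term for matrix coefficients: `M_C ∘ pull s` on the product carrier, sandwiched -/

section ShiftM

variable {X X' : Type} (D : LineData X X') (ι : Type) [Fintype ι]

/-- LEIBNIZ for the third term's shape with a matrix coefficient: `𝔇(M_{C′}∘pull s′, M_C∘pull s) = M_{C′} ∘ 𝔇(pull s′, pull s) + 𝔇(M_{C′}, M_C) ∘ pull s`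
on the product carrier. [folklore] -/
theorem idef_mcoeffShift_eq (C' : X' → Matrix ι ι ℝ) (C : X → Matrix ι ι ℝ) :
    idef (pull (prodLine D ι).π) (pull (prodLine D ι).π) (mmulOp C' ∘ₗ pull (prodLine D ι).s') (mmulOp C ∘ₗ pull (prodLine D ι).s) =
      mmulOp C' ∘ₗ idef (pull (prodLine D ι).π) (pull (prodLine D ι).π) (pull (prodLine D ι).s') (pull (prodLine D ι).s) +
        idef (pull (prodLine D ι).π) (pull (prodLine D ι).π) (mmulOp C') (mmulOp C) ∘ₗ pull (prodLine D ι).s :=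
  idef_comp _ _ _ (mmulOp C') (pull (prodLine D ι).s') (mmulOp C) (pull (prodLine D ι).s)

variable [Fintype X] [Fintype X'] {g : B6.Geometry} (blk : X → g.Site)
variable {F₁ F₃ : Type} [AddCommGroup F₁] [Module ℝ F₁] [AddCommGroup F₃] [Module ℝ F₃] {b₁ : BlockNorm g F₁} {b₃ : BlockNorm g F₃}

omit [Fintype X] in
/-- A matrix coefficient of row sums `≤ α` after the left factor: `T′ ≤ N_T` (`N_T ≥ 0`) ⟹ `T′ ∘ M_{C′} ≤ α·N_T` (14's `hasMaj_mmulOp`). [folklore] -/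
theorem hasMaj_comp_mmulOp_left (blk' : X' → g.Site) {T' : (X' × ι → ℝ) →ₗ[ℝ] F₃} {N_T : g.Site → g.Site → ℝ} {C' : X' → Matrix ι ι ℝ}
    {α : ℝ} (hNT : ∀ a b, 0 ≤ N_T a b) (hα : 0 ≤ α) (hC' : ∀ x' i, ∑ j, |C' x' i j| ≤ α)
    (hT : HasMaj (BlockNorm.ofBlocks g (liftBlk blk' ι)) b₃ T' N_T) :
    HasMaj (BlockNorm.ofBlocks g (liftBlk blk' ι)) b₃ (T' ∘ₗ mmulOp C') (fun y y' => α * N_T y y') := by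
  have hm := hasMaj_mmulOp (g := g) blk' (m := fun _ => α) (fun _ => hα) hC'
  have hκ : (BlockNorm.ofBlocks g (liftBlk blk' ι)).κ = 1 := rfl
  refine (hasMaj_comp hT hm hNT).mono fun y y' => le_of_eq ?_
  simp only [hκ, one_mul]
  rw [sum_mul_diagK]
  ring

/-- **THE THIRD TERM `M_{C₃}∘pull s` FOR MATRIX COEFFICIENTS, SANDWICHED** (15's `hasMaj_comp_idef_coeffShift_comp` with `mulOp ↦ mmulOp`):
`T′ ∘ 𝔇(M_{C′}∘pull s′, M_C∘pull s) ∘ A ≤ (αm_TA₁c_η + m_T(εA_sC))·e^{−ρd(y,y′)}·w(y′)` from `T′ ≤ N_T` (`‖N_T‖_ρ ≤ m_T`), row sums `Σ_j|C′_{ij}| ≤ α`, the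
coarse derivative entry `∇_η∘A ≤ A₁e^{−(ρ+σ)d}`, the SHIFTED right factor `pull s∘A ≤ A_se^{−(ρ+σ)d}`, the max-row-sum fit `o ≤ ε·w`, and `|η| ≤ c_η·w(y′)`;
shift piece = 15's weighted shift sandwich ON `prodLine D ι` BY NAME, coefficient piece = 14's transfer form on the shifted factor. [folklore] -/
theorem hasMaj_comp_idef_mcoeffShift_comp {η : ℝ} (hη : η ≠ 0) (htri : Triangle254 g) (hd : ∀ a b : g.Site, 0 ≤ g.dist a b)
    (hdiag : ∀ y, g.dist y y = 0) {ρ σ C ε As A₁ m_T cη α : ℝ} (hρ : 0 ≤ ρ) (hσ : 0 ≤ σ) (hAs : 0 ≤ As) (hA₁ : 0 ≤ A₁) (hC : 0 ≤ C)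
    (hε : 0 ≤ ε) (hα : 0 ≤ α) {w o : g.Site → ℝ} (hw : ∀ y, 0 ≤ w y) (hsw : SlowWeight g σ C w) (hηw : ∀ y', |η| ≤ cη * w y')
    (ho : ∀ y, 0 ≤ o y) (how : ∀ y, o y ≤ ε * w y)
    {C' : X' → Matrix ι ι ℝ} {Cc : X → Matrix ι ι ℝ} (hC' : ∀ x' i, ∑ j, |C' x' i j| ≤ α)
    (hfit : ∀ x' i, ∑ j, |C' x' i j - Cc (D.π x') i j| ≤ o (blk (D.π x')))
    {T' : (X' × ι → ℝ) →ₗ[ℝ] F₃} {A : F₁ →ₗ[ℝ] (X × ι → ℝ)} {N_T : g.Site → g.Site → ℝ} (hNT : ∀ a b, 0 ≤ N_T a b)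
    (hmT : WRow g ρ N_T m_T) (hT : HasMaj (BlockNorm.ofBlocks g (liftBlk (blk ∘ D.π) ι)) b₃ T' N_T)
    (hdA : HasMaj b₁ (BlockNorm.ofBlocks g (liftBlk blk ι)) (fdiffN η (prodLine D ι).s ∘ₗ A)
      (fun y y' => A₁ * Real.exp (-((ρ + σ) * g.dist y y'))))
    (hsA : HasMaj b₁ (BlockNorm.ofBlocks g (liftBlk blk ι)) (pull (prodLine D ι).s ∘ₗ A)
      (fun y y' => As * Real.exp (-((ρ + σ) * g.dist y y')))) :
    HasMaj b₁ b₃ (T' ∘ₗ idef (pull (prodLine D ι).π) (pull (prodLine D ι).π)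
        (mmulOp C' ∘ₗ pull (prodLine D ι).s') (mmulOp Cc ∘ₗ pull (prodLine D ι).s) ∘ₗ A)
      (fun y y' => (α * m_T * A₁ * cη + m_T * (ε * As * C)) * Real.exp (-(ρ * g.dist y y')) * w y') := by
  -- Leibniz and the sandwich identity
  have hop : T' ∘ₗ idef (pull (prodLine D ι).π) (pull (prodLine D ι).π)
        (mmulOp C' ∘ₗ pull (prodLine D ι).s') (mmulOp Cc ∘ₗ pull (prodLine D ι).s) ∘ₗ A =
      (T' ∘ₗ mmulOp C') ∘ₗ idef (pull (prodLine D ι).π) (pull (prodLine D ι).π)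
          (pull (prodLine D ι).s') (pull (prodLine D ι).s) ∘ₗ A +
        T' ∘ₗ (idef (pull (prodLine D ι).π) (pull (prodLine D ι).π) (mmulOp C') (mmulOp Cc) ∘ₗ (pull (prodLine D ι).s ∘ₗ A)) := by
    rw [idef_mcoeffShift_eq]
    ext v
    simp only [LinearMap.comp_apply, LinearMap.add_apply, map_add]
  rw [hop]
  -- shift piece: `T′∘M_{C′} ≤ αN_T`, then part 15 on the product line data
  have hTc := hasMaj_comp_mmulOp_left (g := g) ι (b₃ := b₃) (blk ∘ D.π) hNT hα hC' hT
  have h1 : HasMaj b₁ b₃ ((T' ∘ₗ mmulOp C') ∘ₗ idef (pull (prodLine D ι).π) (pull (prodLine D ι).π)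
        (pull (prodLine D ι).s') (pull (prodLine D ι).s) ∘ₗ A)
      (fun y y' => (α * m_T * A₁ * cη) * Real.exp (-(ρ * g.dist y y')) * w y') :=
    hasMaj_comp_idef_pull_shift_comp_weighted (prodLine D ι) (liftBlk blk ι) (b₁ := b₁) (b₃ := b₃) hη htri hd hρ hσ hA₁ hηw
      (fun a b => mul_nonneg hα (hNT a b)) (wrow_const_mul hα hmT) hTc hdA
  -- coefficient piece on the shifted right factor
  have hin : HasMaj b₁ (BlockNorm.ofBlocks g (liftBlk (blk ∘ D.π) ι))
      (idef (pull (prodLine D ι).π) (pull (prodLine D ι).π) (mmulOp C') (mmulOp Cc) ∘ₗ (pull (prodLine D ι).s ∘ₗ A))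
      (fun y y' => ε * As * C * Real.exp (-(ρ * g.dist y y')) * w y') :=
    hasMaj_idef_mmulOp_comp_transfer (b₁ := b₁) (ι := ι) blk D.π htri hdiag hρ hAs hC hε hw hsw ho how hfit hsA
  have h2' := hasMaj_comp_wrow_source htri hρ (mul_nonneg (mul_nonneg hε hAs) hC) hNT hw hmT hT hin
  have hκ' : (BlockNorm.ofBlocks g (liftBlk (blk ∘ D.π) ι)).κ = 1 := rfl
  have h2 : HasMaj b₁ b₃
      (T' ∘ₗ (idef (pull (prodLine D ι).π) (pull (prodLine D ι).π) (mmulOp C') (mmulOp Cc) ∘ₗ (pull (prodLine D ι).s ∘ₗ A)))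
      (fun y y' => m_T * (ε * As * C) * Real.exp (-(ρ * g.dist y y')) * w y') := by
    simpa only [hκ', one_mul] using h2'
  refine (h1.add h2).mono fun y y' => le_of_eq ?_
  ring

end ShiftM

/-! ## §2 One direction of `V′₁(A)`: all three terms, sandwiched -/

section V1

variable {X X' : Type} [Fintype X] [Fintype X'] (D : LineData X X') (ι : Type) [Fintype ι] {g : B6.Geometry} (blk : X → g.Site)
variable {F₁ F₃ : Type} [AddCommGroup F₁] [Module ℝ F₁] [AddCommGroup F₃] [Module ℝ F₃] {b₁ : BlockNorm g F₁} {b₃ : BlockNorm g F₃}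

/-- **ONE DIRECTION OF THE PRINT's `V′₁(A)` (3.52), MATRIX COEFFICIENTS, ALL THREE TERMS SANDWICHED.**
Operators on the product carriers (`𝔤 ≅ ℝ^ι`): coarse `V = M_{C₁}∘∇_η + M_{C₂} + M_{C₃}∘pull s`, fine `V′ = M_{C₁′}∘∇′_{η′} + M_{C₂′} + M_{C₃′}∘pull s′`
(`C₁ ↔ ad_{A(b)}`, `C₂ ↔ ad_{(D*A)(x)}`, `C₃ ↔ F′_{1,k}(ad_{A(b)})`, `pull s ↔ λ(b₊)`).  CONCLUSION: `T′ ∘ 𝔇(V′, V) ∘ A ≤ (K₁ + K₂ + K₃)·e^{−ρd(y,y′)}·w(y′)`,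
`K₁ = m₃A₁c′_η + m_T(ε₁A₁C)`, `K₂ = m_T(ε₂A₀C)`, `K₃ = α₃m_TA₁c_η + m_T(ε₃A_sC)`.
BINDER CENSUS (all of printed SHAPE or bookkeeping): geometry `htri` (2.54), `hd`, `hdiag`; weight `w ≥ 0` slow with `(σ, C)` ([B6] (2.60)), `0 ≤ ρ, σ`;
LEFT FACTOR `T′ ≤ N_T`, `‖N_T‖_ρ ≤ m_T` and ITS COMPOSITE ADJOINT-DERIVATIVE ENTRY `(T′∘M_{C₁′})∘∇′* ≤ N₃`, `‖N₃‖_ρ ≤ m₃` ((3.42)₃; 14's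
`hasMaj_comp_mmulOp_bdiffN` supplies it from `T′`'s own entry + row letters); RIGHT FACTOR `A ≤ A₀e^{−(ρ+σ)d}`, its derivative entry `∇_η∘A ≤ A₁e^{−(ρ+σ)d}`
((3.42)₂) and its shifted form `pull s∘A ≤ A_se^{−(ρ+σ)d}` (15's `hasMaj_pull_comp_of_reach`); COEFFICIENTS: max-row-sum fits `o_k ≤ ε_k·w` (k = 1,2,3;
§3 ∕ 16 from the field letters) and `Σ_j|C₃′_{ij}| ≤ α₃`; RATE FACTORS `|η′|(M−1) ≤ c′_η·w(y′)`, `|η| ≤ c_η·w(y′)` (`= 1` for the η-rate weight `L^{−j} ≥ η`).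
[folklore] -/
theorem hasMaj_comp_idef_V1dir_comp {η η' : ℝ} (hη : η ≠ 0) (hη' : η' ≠ 0) (hMη : (D.M : ℝ) * η' = η) (htri : Triangle254 g)
    (hd : ∀ a b : g.Site, 0 ≤ g.dist a b) (hdiag : ∀ y, g.dist y y = 0)
    {ρ σ C ε₁ ε₂ ε₃ A₀ A₁ As m_T m₃ cη cη' α₃ : ℝ} (hρ : 0 ≤ ρ) (hσ : 0 ≤ σ) (hA₀ : 0 ≤ A₀) (hA₁ : 0 ≤ A₁) (hAs : 0 ≤ As)
    (hC : 0 ≤ C) (hε₁ : 0 ≤ ε₁) (hε₂ : 0 ≤ ε₂) (hε₃ : 0 ≤ ε₃) (hα₃ : 0 ≤ α₃)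
    {w o₁ o₂ o₃ : g.Site → ℝ} (hw : ∀ y, 0 ≤ w y) (hsw : SlowWeight g σ C w)
    (hηw' : ∀ y', |η'| * ((D.M : ℝ) - 1) ≤ cη' * w y') (hηw : ∀ y', |η| ≤ cη * w y')
    (ho₁ : ∀ y, 0 ≤ o₁ y) (how₁ : ∀ y, o₁ y ≤ ε₁ * w y) (ho₂ : ∀ y, 0 ≤ o₂ y) (how₂ : ∀ y, o₂ y ≤ ε₂ * w y)
    (ho₃ : ∀ y, 0 ≤ o₃ y) (how₃ : ∀ y, o₃ y ≤ ε₃ * w y)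
    {C₁' C₂' C₃' : X' → Matrix ι ι ℝ} {C₁ C₂ C₃ : X → Matrix ι ι ℝ}
    (hfit₁ : ∀ x' i, ∑ j, |C₁' x' i j - C₁ (D.π x') i j| ≤ o₁ (blk (D.π x')))
    (hfit₂ : ∀ x' i, ∑ j, |C₂' x' i j - C₂ (D.π x') i j| ≤ o₂ (blk (D.π x')))
    (hfit₃ : ∀ x' i, ∑ j, |C₃' x' i j - C₃ (D.π x') i j| ≤ o₃ (blk (D.π x')))
    (hC₃' : ∀ x' i, ∑ j, |C₃' x' i j| ≤ α₃)
    {T' : (X' × ι → ℝ) →ₗ[ℝ] F₃} {A : F₁ →ₗ[ℝ] (X × ι → ℝ)} {N_T N₃ : g.Site → g.Site → ℝ}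
    (hNT : ∀ a b, 0 ≤ N_T a b) (hmT : WRow g ρ N_T m_T) (hT : HasMaj (BlockNorm.ofBlocks g (liftBlk (blk ∘ D.π) ι)) b₃ T' N_T)
    (hN₃ : ∀ a b, 0 ≤ N₃ a b) (hm₃ : WRow g ρ N₃ m₃)
    (hS : HasMaj (BlockNorm.ofBlocks g (liftBlk (blk ∘ D.π) ι)) b₃ ((T' ∘ₗ mmulOp C₁') ∘ₗ bdiffN η' (prodLine D ι).s') N₃)
    (hA : HasMaj b₁ (BlockNorm.ofBlocks g (liftBlk blk ι)) A (fun y y' => A₀ * Real.exp (-((ρ + σ) * g.dist y y'))))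
    (hdA : HasMaj b₁ (BlockNorm.ofBlocks g (liftBlk blk ι)) (fdiffN η (prodLine D ι).s ∘ₗ A)
      (fun y y' => A₁ * Real.exp (-((ρ + σ) * g.dist y y'))))
    (hsA : HasMaj b₁ (BlockNorm.ofBlocks g (liftBlk blk ι)) (pull (prodLine D ι).s ∘ₗ A)
      (fun y y' => As * Real.exp (-((ρ + σ) * g.dist y y')))) :
    HasMaj b₁ b₃ (T' ∘ₗ idef (pull (prodLine D ι).π) (pull (prodLine D ι).π)
        (mmulOp C₁' ∘ₗ fdiffN η' (prodLine D ι).s' + mmulOp C₂' + mmulOp C₃' ∘ₗ pull (prodLine D ι).s')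
        (mmulOp C₁ ∘ₗ fdiffN η (prodLine D ι).s + mmulOp C₂ + mmulOp C₃ ∘ₗ pull (prodLine D ι).s) ∘ₗ A)
      (fun y y' => ((m₃ * A₁ * cη' + m_T * (ε₁ * A₁ * C)) + m_T * (ε₂ * A₀ * C) + (α₃ * m_T * A₁ * cη + m_T * (ε₃ * As * C))) *
        Real.exp (-(ρ * g.dist y y')) * w y') := by
  -- the three sandwiched terms
  have h1 := hasMaj_comp_idef_firstOrderM_comp D ι blk (b₁ := b₁) (b₃ := b₃) hη' hMη htri hd hdiag hρ hσ hA₁ hC hε₁ hw hsw hηw'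
    ho₁ how₁ hfit₁ hNT hmT hT hN₃ hm₃ hS hdA
  have h2 := hasMaj_comp_idef_mmulOp_comp (b₁ := b₁) (b₃ := b₃) (ι := ι) blk D.π htri hdiag hρ hA₀ hC hε₂ hw hsw ho₂ how₂ hfit₂
    hNT hmT hT hA
  have h3 := hasMaj_comp_idef_mcoeffShift_comp D ι blk (b₁ := b₁) (b₃ := b₃) hη htri hd hdiag hρ hσ hAs hA₁ hC hε₃ hα₃ hw hsw hηw
    ho₃ how₃ hC₃' hfit₃ hNT hmT hT hdA hsA
  -- the defect is additive and so is the sandwich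
  have hop : T' ∘ₗ idef (pull (prodLine D ι).π) (pull (prodLine D ι).π)
        (mmulOp C₁' ∘ₗ fdiffN η' (prodLine D ι).s' + mmulOp C₂' + mmulOp C₃' ∘ₗ pull (prodLine D ι).s')
        (mmulOp C₁ ∘ₗ fdiffN η (prodLine D ι).s + mmulOp C₂ + mmulOp C₃ ∘ₗ pull (prodLine D ι).s) ∘ₗ A =
      T' ∘ₗ idef (pull (prodLine D ι).π) (pull (prodLine D ι).π)
          (mmulOp C₁' ∘ₗ fdiffN η' (prodLine D ι).s') (mmulOp C₁ ∘ₗ fdiffN η (prodLine D ι).s) ∘ₗ A +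
        T' ∘ₗ idef (pull (prodLine D ι).π) (pull (prodLine D ι).π) (mmulOp C₂') (mmulOp C₂) ∘ₗ A +
        T' ∘ₗ idef (pull (prodLine D ι).π) (pull (prodLine D ι).π)
          (mmulOp C₃' ∘ₗ pull (prodLine D ι).s') (mmulOp C₃ ∘ₗ pull (prodLine D ι).s) ∘ₗ A := by
    rw [idef_add, idef_add]
    ext v
    simp only [LinearMap.comp_apply, LinearMap.add_apply, map_add]
  rw [hop]
  refine ((h1.add h2).add h3).mono fun y y' => le_of_eq ?_
  ring

end V1

/-! ## §3 The three coefficient letter sets from field letters, in coordinates (part 16's `κ_e`) -/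

section Letters

variable {ι : Type} [Fintype ι] [DecidableEq ι] {𝔄 : Type} [NormedRing 𝔄] [NormedAlgebra ℝ 𝔄] (e : 𝔄 ≃L[ℝ] (ι → ℝ))
variable {X X' : Type}

/-- THE LINEAR SPECIES `ad` (coefficients `C₁ = ad_{A(b)}` and `C₂ = ad_{(D*A)(x)}`): from a field fit `‖A′(x′) − Ā(πx′)‖ ≤ o(πx′)` the coordinate
matrices of `ad_{A′}`, `ad_{Ā}` have max-row-sum fit `≤ κ_e·2·o(πx′)` (13a `norm_adCLM_sub_le` + 16 `rowFit_of_opNormFit`). [folklore] -/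
theorem rowFit_ad (π : X' → X) {a' : X' → 𝔄} {a : X → 𝔄} {o : X → ℝ} (hfit : ∀ x', ‖a' x' - a (π x')‖ ≤ o (π x')) (x' : X') (i : ι) :
    ∑ j, |coordMat e (adCLM ℝ (a' x')) i j - coordMat e (adCLM ℝ (a (π x'))) i j| ≤ basisConst e * (2 * o (π x')) :=
  rowFit_of_opNormFit e π (C' := fun x' => adCLM ℝ (a' x')) (C := fun x => adCLM ℝ (a x)) (o := fun x => 2 * o x)
    (fun x' => (norm_adCLM_sub_le (a' x') (a (π x'))).trans (mul_le_mul_of_nonneg_left (hfit x') (by norm_num))) x' i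

/-- Row letter `α` for `ad`: `‖A(x)‖ ≤ r` ⟹ rows of `coordMat e (ad_{A(x)})` are `≤ κ_e·(2r)` (13a `norm_adCLM_le_of_le`). [folklore] -/
theorem rowBound_ad {a : X → 𝔄} {r : ℝ} (ha : ∀ x, ‖a x‖ ≤ r) (x : X) (i : ι) :
    ∑ j, |coordMat e (adCLM ℝ (a x)) i j| ≤ basisConst e * (2 * r) :=
  rowBound_of_opNormBound e (C := fun x => adCLM ℝ (a x)) (fun x => norm_adCLM_le_of_le (ha x)) x i

/-- Row letter `G` for `ad` (the binder `hda` of 14's `hasMaj_comp_mmulOp_bdiffN`): from the (3.35)-SHAPED bond letter `‖A′(x′) − A′(s′⁻¹x′)‖ ≤ η′·G`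
(`η′ > 0`), the backward difference quotients of the coordinate matrices of `ad_{A′}` have rows `≤ κ_e·(2G)`. [folklore] -/
theorem rowDiff_ad {a' : X' → 𝔄} (s' : X' ≃ X') {η' G : ℝ} (hη' : 0 < η') (hG : ∀ x', ‖a' x' - a' (s'.symm x')‖ ≤ η' * G)
    (x' : X') (i : ι) :
    ∑ j, |η'⁻¹ * (coordMat e (adCLM ℝ (a' x')) i j - coordMat e (adCLM ℝ (a' (s'.symm x'))) i j)| ≤ basisConst e * (2 * G) := by
  have hrow := row_abs_sum_coordMat_le e (adCLM ℝ (a' x') - adCLM ℝ (a' (s'.symm x'))) i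
  rw [coordMat_sub] at hrow
  have had : ‖adCLM ℝ (a' x') - adCLM ℝ (a' (s'.symm x'))‖ ≤ 2 * (η' * G) :=
    (norm_adCLM_sub_le _ _).trans (mul_le_mul_of_nonneg_left (hG x') (by norm_num))
  have hκ := basisConst_nonneg e
  calc ∑ j, |η'⁻¹ * (coordMat e (adCLM ℝ (a' x')) i j - coordMat e (adCLM ℝ (a' (s'.symm x'))) i j)|
      = η'⁻¹ * ∑ j, |(coordMat e (adCLM ℝ (a' x')) - coordMat e (adCLM ℝ (a' (s'.symm x')))) i j| := by
        rw [Finset.mul_sum]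
        refine Finset.sum_congr rfl fun j _ => ?_
        rw [abs_mul, abs_of_pos (inv_pos.2 hη'), Matrix.sub_apply]
    _ ≤ η'⁻¹ * (basisConst e * (2 * (η' * G))) :=
        mul_le_mul_of_nonneg_left (hrow.trans (mul_le_mul_of_nonneg_left had hκ)) (inv_nonneg.2 hη'.le)
    _ = basisConst e * (2 * G) := by field_simp

variable [CompleteSpace 𝔄]

omit [DecidableEq ι] in
/-- The size of the second-order species: `Phi2 η 0 = 0` and `Phi2(η, ·)` is `(e·ρ)`-Lipschitz on `‖Z‖ ≤ ρ` (13b, regime `η₀ρ ≤ 1`), hence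
`‖Phi2 η Z‖ ≤ e·ρ·‖Z‖`. [folklore] -/
theorem norm_Phi2_le {𝔅 : Type} [NormedRing 𝔅] [NormedAlgebra ℝ 𝔅] [CompleteSpace 𝔅] {η₀ ρ s : ℝ} (hreg : η₀ * ρ ≤ 1) (hρ : 0 ≤ ρ)
    (hs0 : 0 ≤ s) (hs : s ≤ η₀) {Z : 𝔅} (hZ : ‖Z‖ ≤ ρ) : ‖Phi2 s Z‖ ≤ Real.exp 1 * ρ * ‖Z‖ := by
  have h0 : Phi2 s (0 : 𝔅) = 0 := by
    unfold Phi2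
    split_ifs <;> simp
  have h := Phi2_lipschitz hreg s hs0 hs Z 0 hZ (by simpa using hρ)
  rwa [h0, sub_zero, sub_zero] at h

/-- Row letter `α₃` for `C₃ = F′_{1,k}(ad_A)` in coordinates: `‖A(x)‖ ≤ r`, regime `η₀(2r) ≤ 1`, `0 ≤ η ≤ η₀` ⟹ rows `≤ κ_e·(e(2r)·(2r))`. [folklore] -/
theorem rowBound_Phi2_ad {a : X → 𝔄} {η₀ r η : ℝ} (hreg : η₀ * (2 * r) ≤ 1) (hr : 0 ≤ r) (hη0 : 0 ≤ η) (hη : η ≤ η₀)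
    (ha : ∀ x, ‖a x‖ ≤ r) (x : X) (i : ι) :
    ∑ j, |coordMat e (Phi2 η (adCLM ℝ (a x))) i j| ≤ basisConst e * (Real.exp 1 * (2 * r) * (2 * r)) :=
  rowBound_of_opNormBound e (C := fun x => Phi2 η (adCLM ℝ (a x))) (fun x =>
    (norm_Phi2_le hreg (by positivity) hη0 hη (norm_adCLM_le_of_le (ha x))).trans
      (mul_le_mul_of_nonneg_left (norm_adCLM_le_of_le (ha x)) (by positivity))) x i

/-- THE FIT OF `C₃ = F′_{1,k}(ad_A)` in coordinates (13b `fit_Phi2_ad` through 16): `Σ_j |coordMat(Phi2(η′, ad A′x′)) − coordMat(Phi2(η, ad Ā(πx′)))|_{ij}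
≤ κ_e·(2e(2r)·o(πx′) + 2e(2r)³·η)`. [folklore] -/
theorem rowFit_Phi2_ad (π : X' → X) {η₀ r η η' : ℝ} (hreg : η₀ * (2 * r) ≤ 1) (hr : 0 ≤ r) (hη' : 0 ≤ η') (hη'η : η' ≤ η)
    (hη : η ≤ η₀) {a' : X' → 𝔄} {a : X → 𝔄} (ha' : ∀ x', ‖a' x'‖ ≤ r) (ha : ∀ x, ‖a x‖ ≤ r)
    {o : X → ℝ} (hfit : ∀ x', ‖a' x' - a (π x')‖ ≤ o (π x')) (x' : X') (i : ι) :
    ∑ j, |coordMat e (Phi2 η' (adCLM ℝ (a' x'))) i j - coordMat e (Phi2 η (adCLM ℝ (a (π x')))) i j| ≤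
      basisConst e * ((2 * (Real.exp 1 * (2 * r))) * o (π x') + 2 * (Real.exp 1 * (2 * r) ^ 3) * η) :=
  rowFit_of_opNormFit e π (C' := fun x' => Phi2 η' (adCLM ℝ (a' x'))) (C := fun x => Phi2 η (adCLM ℝ (a x)))
    (o := fun x => (2 * (Real.exp 1 * (2 * r))) * o x + 2 * (Real.exp 1 * (2 * r) ^ 3) * η)
    (fun x' => fit_Phi2_ad π hreg hr hη' hη'η hη ha' ha hfit x') x' i

end Letters

end Summit.QuantumFields.YangMills.BalabanUVNodes.N15.MatrixSpecies
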